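import Literature.NumberTheory.PAdicHodge.UnitRootFrameReciprocityFormalPoint
import Literature.NumberTheory.PAdicHodge.TatePairingPointOfKTwoTransport
import HarnessLib

/-!
# Kato's explicit reciprocity law at a completion for a curve `W/K₀` ISOMORPHIC over `F = K_v` to a ramified good ORDINARY model —
# the unit-root frame ALONG THE TRANSPORT `φ`

Topic `Literature/NumberTheory/PAdicHodge`; THEOREMS ONLY (no definition, no named fact, no instance, no `sorry`). The `φ`-twins of
`UnitRootFrameKummerPackage.exists_kummerPackage_through_iota` and
`UnitRootFrameReciprocityFormalPoint.exists_const_tatePairingPoint_eq_neg_trace_unitRoot_formalPoint`, which treat the good ORDINARY `𝒪_D`-model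
`E = curveFO F (W_D ⊗_ψ 𝒪_F)` ITSELF (`φ = id`). Here `W` is any elliptic curve over a subfield `K₀ ⊆ F` together with a `Γ_F`-equivariant
isomorphism of geometric points `φ : (W ×_{K₀} F)(F̄) ≃ E(F̄)` and its Tate-module map `T_p(φ)` (brick G1 `TatePairingPointOfKTwoTransport`:
`tateMap_smul`, `map_divSeq(_fix)`); the K★ cells take `K₀ = ℚ`, `W = W_min`, `F = ℚ_p(ζ_m)_w(ϖ)` and `φ` the admissible change of variables onto the
good model — the ordinary analogue of `BmaxPlusTransportedReciprocityTransport` (supersingular models, matching `θ_∞ ≫ T_p(φ) ≫ e`). At ORDINARY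
reduction the formal Tate module `T_pŴ_D = ℤ_p v₀` has rank one and only EMBEDS into `T_pE` (`ι`, `FormalTateModuleInclusion`); the frame vector of
`W` is **`w₀′ := θ_∞⁻¹(T_p(φ)⁻¹(ι v₀)) ∈ T_pW`**.

* §1 (any `p`-adic field `F`) `restrictedTateRep_frameVector_transport` — `w₀′ ≠ 0`, `ρ(σ) ≠ 0`, `σ|w₀′ = ρ(σ)w₀′` under `restrictedTateRep W`
  (`ι` injective equivariant, `T_p(φ)` and `θ_∞` equivariant); ★★ `exists_kummerPackage_through_iota_transport` — for `P ∈ W(F)` with a `p`-power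
  division tower `Q` in `W(F̄)` whose image `φ ∘ Q` consists of FORMAL points of the model (`‖z(φ Q₀)‖^N ≤ ‖p‖`): a continuous cocycle `κ` of
  `T_pW|_{Γ_F}` whose level classes are the Kummer classes of `P` IN `W`, `k : Γ_F → ℤ_p` with **`κ(σ) = k(σ)•w₀′`** (`T_p(φ)θ_∞κ = (σφQₙ − φQₙ)ₙ =
  ι(κ_u σ)`, `κ_u(σ) = k(σ)v₀`), and the SAME crystalline `Λ = Λ_N(Tu)` of the Kummer tower `u = z(φ∘Q)` with Dieudonné–Honda, `σΛ = Λ + k(σ)·LT(v₀)`,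
  `θ(ι(A)fΛ + ι(B)fφΛ) = c_P`.
* §2 (`F = K_v`) ★★★★ `exists_const_tatePairingPoint_eq_neg_trace_unitRoot_formalPoint_transport` — GIVEN the cell data OF `W` (Weil tower, `ψ = log χ`,
  `hinj/hde/d`), `LT`, `v₀, ρ`, a Hodge line `(A, B, d)`, the unit root `α` and `H₀ ≠ 0` (all data of the MODEL, as in the `φ = id` file), ONE `c ∈ F`
  gives **`⟨[η], P⟩_W = −Tr_{F/ℚ_p}(c_P · exp*_d(η) · c)`** for every cocycle `η` of `T_pW|_{Γ_F}`, every `P ∈ W(F)` with a tower `Q` whose image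
  `φ ∘ Q` is formal and deep, every `c_P` with `ι(c_P) = p^N·Σ'[Xʲ]log_{W_D}·z(φ Q₀)ʲ` — pairing, `exp*`, `d`, representation of `W` ITSELF, periods of
  the model. Proof: `UnitRootFrameReciprocity.exists_const_tatePairingPoint_eq_neg_trace_unitRootFrame` (generic in the curve) at the transported frame
  `w₀′`, fed by §1.

Purpose: crux K★ `stmt-BirchSwinnertonDyer-22226` (route `EdixhovenFibreFiveSeven`, line `kato_lever`, stub `stub_localFormulaOrdinaryCells`): the
`∀ φ (hφ) (Tφ) (hTφ)` layer of the ordinary capstone socket `hcap` of `Summits/…/Theorems/…LocalFormulaOrdinaryCellsOfCapstone` (memos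
`Cruxes/StarredOptimalManinUnitFiveSeven/Lines/kato-lever-ordinary-cells-width.md` §5, `…/kato-lever-seam-rec-at-cells.md` §17–§18). HONEST LIMITS:
`H₀ ≠ 0`, the construction of `LT / v₀ / ρ / (A, B) / α` from the cell data, and the cells are NOT here; BSD / K★ / [REC-tower] are NOT proved here.

## References
* K. Kato, LNM 1553 (1993), Ch. II §1.4, Thm. 1.4.1 (3)–(4), Lemma 1.4.3 [Kato1993LNM1553]; S. Bloch, K. Kato (1990), Ex. 3.10.1, 3.11 [BlochKato1990]
* P. Colmez, Math. Ann. 292 (1992), §2 [Colmez1992PeriodesAbeliennes]; N. M. Katz (1981), Thm. 5.1.4–5.1.5 [Katz1981CrystallineDieudonne]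
* J. Tate, *p-divisible groups* (1967), §4 [Tate1967]; J. H. Silverman, *AEC* (2009), III §7, Prop. VII.2.2, VIII §2, X §4 [SilvermanAEC2009]
-/

noncomputable section

open Field Function ValuativeRel WittVector NumberField IsDedekindDomain
open scoped NumberField Topology

namespace Literature.NumberTheory.PAdicHodge

open Literature.NumberTheory.GaloisRepresentations Literature.NumberTheory.GaloisRepresentations.IsNonarchimedeanLocalField
open Literature.NumberTheory.GaloisRepresentations.LubinTate Literature.NumberTheory.GaloisCohomology
open Literature.NumberTheory.EllipticCurves Literature.NumberTheory.EllipticCurves.FormalGroupChart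
open Literature.NumberTheory.PAdicHodge.GaloisContinuity Literature.IUT.LogVolume
open Literature.RingTheory.FormalGroups Literature.AlgebraicGeometry.Resolution _root_.WeierstrassCurve

/-! ## §1 The frame vector and the per-point Kummer package ALONG `φ` (any `p`-adic field `F`) -/

section Local

variable {F : Type} [Field F] [ValuativeRel F] [TopologicalSpace F] [IsNonarchimedeanLocalField F] [CharZero F]
  {p : ℕ} [hpp : Fact p.Prime] [Fact (¬ IsUnit (p : integerC F))] [IsAdicComplete (Ideal.span {(p : integerC F)}) (integerC F)]
  (hp : valuation F p < 1) (D : EisensteinRoot F p hp) [CharZero (CompletedAlgClosure F)]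
  (Wm : WeierstrassCurve (EisensteinRoot.CoeffDisc D))
  (ψm : EisensteinRoot.CoeffDisc D →+* LTCoeff F) (hψm : ∀ c, algebraMap (LTCoeff F) F (ψm c) = EisensteinRoot.CoeffDisc.toF D c)
  [(curveOver (CompletedAlgClosure F) (Wm.map ψm)).IsElliptic]
  -- the curve `W/K₀`, the isomorphism of geometric points onto the good model, and its Tate-module map
  {K₀ : Type} [Field K₀] [CharZero K₀] (W : WeierstrassCurve K₀) [W.IsElliptic] [Algebra K₀ F]
  (φ : geomPoints (W.baseChange F) ≃+ (AinfTop.curveFO F (Wm.map ψm)).geomPoints)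
  (hφ : ∀ (σ : absoluteGaloisGroup F) (P : geomPoints (W.baseChange F)), φ (σ • P) = σ • φ P)
  (Tφ : (W.baseChange F).tateModule p ≃ₗ[ℤ_[p]] (AinfTop.curveFO F (Wm.map ψm)).tateModule p)
  (hTφ : ∀ (a : (W.baseChange F).tateModule p) (n : ℕ), TateModule.proj p n (Tφ a) = φ (TateModule.proj p n a))

omit [Fact (¬ IsUnit (p : integerC F))] [IsAdicComplete (Ideal.span {(p : integerC F)}) (integerC F)]
  [CharZero (CompletedAlgClosure F)] in
include hφ hTφ in
/-- **The transported frame vector `w₀′ = θ_∞⁻¹(T_p(φ)⁻¹(ι v₀))` is non-zero, and `Γ_F` acts on it by `ρ`** (through `restrictedTateRep W`):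
`ι` is injective and equivariant (`FormalTateModuleInclusion`), `T_p(φ)` is equivariant (`tateMap_smul`), `θ_∞⁻¹` is equivariant along
`absGaloisRestrict` (`tateModuleEquiv_symm_smul`); `ρ(σ) ≠ 0` since `σ` is invertible on `T_pŴ_D ∋ v₀ ≠ 0`. [cite: Tate1967, §4]
[cite: SilvermanAEC2009, III.§7 and Prop. VII.2.2] -/
theorem restrictedTateRep_frameVector_transport (hΔ : IsUnit (Wm.map ψm).Δ) {v₀ : AinfTop.TatePtO F (Wm.map ψm) p} (hv₀ : v₀ ≠ 0)
    (ρ : absoluteGaloisGroup F → ℤ_[p]) (hρv : ∀ σ : absoluteGaloisGroup F, σ • v₀ = ρ σ • v₀) :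
    (tateModuleEquiv W F p).symm (Tφ.symm
        ((AinfTop.tateGeomEquivCO F (Wm.map ψm) p hΔ).symm (tateModuleOfPt (CompletedAlgClosure F) (Wm.map ψm) p v₀))) ≠ 0 ∧
      (∀ σ, ρ σ ≠ 0) ∧
      ∀ σ : absoluteGaloisGroup F, restrictedTateRep W F p σ
        ((tateModuleEquiv W F p).symm (Tφ.symm
          ((AinfTop.tateGeomEquivCO F (Wm.map ψm) p hΔ).symm (tateModuleOfPt (CompletedAlgClosure F) (Wm.map ψm) p v₀)))) =
        (ρ σ • (tateModuleEquiv W F p).symm (Tφ.symm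
          ((AinfTop.tateGeomEquivCO F (Wm.map ψm) p hΔ).symm (tateModuleOfPt (CompletedAlgClosure F) (Wm.map ψm) p v₀))) :
            W.tateModule p) := by
  refine ⟨fun h0 => hv₀ ?_, fun σ hσ => hv₀ ?_, fun σ => ?_⟩
  · have h1 := (tateModuleEquiv W F p).symm.injective (h0.trans (map_zero _).symm)
    have h2 := Tφ.symm.injective (h1.trans (map_zero _).symm)
    exact AinfTop.tateGeomEquivCO_symm_tateModuleOfPt_injective (Wm.map ψm) hΔ (h2.trans
      (by rw [map_zero, map_zero] : ((AinfTop.tateGeomEquivCO F (Wm.map ψm) p hΔ).symm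
        (tateModuleOfPt (CompletedAlgClosure F) (Wm.map ψm) p 0)) = 0).symm)
  · have h1 : σ • v₀ = 0 := by rw [hρv σ, hσ, zero_smul]
    have h2 := congrArg (fun y : AinfTop.TatePtO F (Wm.map ψm) p => σ⁻¹ • y) h1
    simp only [inv_smul_smul, smul_zero] at h2
    exact h2
  · rw [restrictedTateRep_apply_apply, ← tateModuleEquiv_symm_smul]
    -- `σ • ι v₀ = ρ σ • ι v₀` in `T_pE`
    have h : σ • (AinfTop.tateGeomEquivCO F (Wm.map ψm) p hΔ).symm (tateModuleOfPt (CompletedAlgClosure F) (Wm.map ψm) p v₀) =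
        ρ σ • (AinfTop.tateGeomEquivCO F (Wm.map ψm) p hΔ).symm (tateModuleOfPt (CompletedAlgClosure F) (Wm.map ψm) p v₀) := by
      rw [← AinfTop.tateGeomEquivCO_symm_tateModuleOfPt_smul (Wm.map ψm) hΔ σ v₀, hρv σ]
      exact (congrArg (AinfTop.tateGeomEquivCO F (Wm.map ψm) p hΔ).symm
        (LinearMap.map_smul (tateModuleOfPt (CompletedAlgClosure F) (Wm.map ψm) p) (ρ σ) v₀)).trans
        (LinearEquiv.map_smul (AinfTop.tateGeomEquivCO F (Wm.map ψm) p hΔ).symm (ρ σ) _)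
    -- `σ • T_p(φ)⁻¹(ι v₀) = T_p(φ)⁻¹(σ • ι v₀) = ρ σ • T_p(φ)⁻¹(ι v₀)`
    have hT : σ • Tφ.symm ((AinfTop.tateGeomEquivCO F (Wm.map ψm) p hΔ).symm (tateModuleOfPt (CompletedAlgClosure F) (Wm.map ψm) p v₀)) =
        ρ σ • Tφ.symm ((AinfTop.tateGeomEquivCO F (Wm.map ψm) p hΔ).symm (tateModuleOfPt (CompletedAlgClosure F) (Wm.map ψm) p v₀)) := by
      apply Tφ.injective
      rw [tateMap_smul W φ hφ Tφ hTφ, LinearEquiv.map_smul, LinearEquiv.apply_symm_apply, h]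
    exact (congrArg (tateModuleEquiv W F p).symm hT).trans (LinearEquiv.map_smul (tateModuleEquiv W F p).symm (ρ σ) _)

variable (E₀ : WeierstrassCurve ℤ)
  (hWE : Wm.map (Ideal.Quotient.mk (Ideal.span {EisensteinRoot.CoeffDisc.of D (AdjoinRoot.root D.poly)})) =
    (E₀.map (algebraMap ℤ (EisensteinRoot.CoeffDisc D))).map
      (Ideal.Quotient.mk (Ideal.span {EisensteinRoot.CoeffDisc.of D (AdjoinRoot.root D.poly)})))
  [(E₀.map (Int.castRingHom ℚ_[p])).IsElliptic] [(E₀.map (Int.castRingHom (ZMod p))).IsElliptic]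

include hWE hψm hφ hTφ in
set_option maxHeartbeats 3200000 in
/-- ★★ **The per-point Kummer package through `ι` ALONG THE TRANSPORT `φ`** — the `φ`-twin of `exists_kummerPackage_through_iota` (`φ = id`).
Let `LT : T_pŴ_D → A_max` be the transported period map at an index `N ≥ e` (`hLT`, `ℤ_p`-linearity `hsmul`), `v₀` a generator of `T_pŴ_D`,
`(A, B, d)` a Hodge line, and `P ∈ W(F)` a point of `W` with a `p`-power division tower `Q` in `W(F̄)` (`Q₀ = P`) whose image `φ ∘ Q` consists of
FORMAL points of the model with `‖z(φ Q₀)‖^N ≤ ‖p‖`, and `ι(c_P) = p^N·Σ'[Xʲ]log_{W_D}·z(φ Q₀)ʲ`. Then there are a continuous cocycle `κ` of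
`T_pW|_{Γ_F}` with the Kummer classes of `P` (in `W`) as level classes, `k : Γ_F → ℤ_p` with `κ(σ) = k(σ)•θ_∞⁻¹(T_p(φ)⁻¹(ι v₀))`, and
`Λ ∈ B_max⁺` with `φ²Λ − a_p(E₀)φΛ + pΛ = 0`, `σΛ = Λ + k(σ)·LT(v₀)` and `θ(ι(A)fΛ + ι(B)fφΛ) = c_P`.
[cite: Kato1993LNM1553, Ch. II §1.4 and Lemma 1.4.3] [cite: BlochKato1990, Example 3.11] [cite: Colmez1992PeriodesAbeliennes, §2]
[cite: Katz1981CrystallineDieudonne, Thm. 5.1.4–5.1.5] [cite: SilvermanAEC2009, Prop. VII.2.2, VIII §2 and X §4] -/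
theorem exists_kummerPackage_through_iota_transport (hΔ : IsUnit (Wm.map ψm).Δ) {N : ℕ} (hN : D.e ≤ N)
    {LT : AinfTop.TatePtO F (Wm.map ψm) p →+ BmaxPlus F p}
    (hLT : ∀ (τ : AinfTop.TatePtO F (Wm.map ψm) p) (w : ℕ → (maxNilIdealC F).toIdeal) (hw : ∀ n, AinfTop.mulPC F p E₀ (w (n + 1)) = w n)
        (_ : ∀ n, ‖(((w n : (maxNilIdealC F).toIdeal) : CBall F) : CompletedAlgClosure F) -
      (((AinfTop.seqO (Wm.map ψm) τ n : (maxNilIdealC F).toIdeal) : CBall F) : CompletedAlgClosure F)‖ ≤ ‖((D.rootC : integerC F) : CompletedAlgClosure F)‖)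
        (z : bmaxZero F p), algebraMap (Ainf (p := p) F) (bmaxZero F p)
        ((AinfTop.of F p).symm (((AinfTop.divisionLiftPt E₀ (surjective_fontaineTheta_integerC hp) w hw).val :
          (AinfTop.nilTheta F p (surjective_fontaineTheta_integerC hp)).toIdeal) : AinfTop F p)) ^ N = (p : bmaxZero F p) * z →
        LT τ = PadicLogSeries.logSum ((algebraMap (Ainf (p := p) F) (bmaxZero F p)).comp zpToAinf) (GaloisContinuity.formalLogNum E₀ p) N
          (algebraMap (Ainf (p := p) F) (bmaxZero F p)
            ((AinfTop.of F p).symm (((AinfTop.divisionLiftPt E₀ (surjective_fontaineTheta_integerC hp) w hw).val :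
              (AinfTop.nilTheta F p (surjective_fontaineTheta_integerC hp)).toIdeal) : AinfTop F p))) z)
    (hsmul : ∀ (c : ℤ_[p]) (τ : AinfTop.TatePtO F (Wm.map ψm) p), LT (c • τ) = ainfToBmaxPlus F p (zpToAinf c) * LT τ)
    {v₀ : AinfTop.TatePtO F (Wm.map ψm) p} (hgen : ∀ τ : AinfTop.TatePtO F (Wm.map ψm) p, ∃ c : ℤ_[p], τ = c • v₀)
    (A B : F) (dHL : ℕ)
    (hHL : ∀ n : ℕ, ‖(p : CompletedAlgClosure F) ^ dHL * PowerSeries.coeff n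
        ((Wm.map ((CBall F).subtype.comp (EisensteinRoot.CoeffDisc.toCBall D))).formalLog -
          PowerSeries.C (algebraMap F (CompletedAlgClosure F) A) * (E₀.map (Int.castRingHom (CompletedAlgClosure F))).formalLog -
          PowerSeries.C (algebraMap F (CompletedAlgClosure F) B) *
            PowerSeries.expand p hpp.out.ne_zero (E₀.map (Int.castRingHom (CompletedAlgClosure F))).formalLog)‖ ≤ 1)
    (P : (W.baseChange F).toAffine.Point)
    (Q : ℕ → geomPoints (W.baseChange F)) (hQ : ∀ n, p • Q (n + 1) = Q n)
    (hQ0 : Q 0 = toGeomPoints (W.baseChange F) P)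
    (hker : ∀ n, AinfTop.geomToCO (Wm.map ψm) ((⇑φ ∘ Q) n) ∈ kernel (NormedField.valuation (K := CompletedAlgClosure F))
      (curveOver (CompletedAlgClosure F) (Wm.map ψm)))
    (huN : ‖((zPt (AinfTop.geomToCO (Wm.map ψm) ((⇑φ ∘ Q) 0)) (hker 0) : CBall F) : CompletedAlgClosure F)‖ ^ N ≤ ‖(p : CompletedAlgClosure F)‖)
    (cP : F)
    (hcP : algebraMap F (CompletedAlgClosure F) cP = (p : CompletedAlgClosure F) ^ N *
        ∑' j : ℕ, PowerSeries.coeff j (Wm.map ((CBall F).subtype.comp (EisensteinRoot.CoeffDisc.toCBall D))).formalLog *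
          ((zPt (AinfTop.geomToCO (Wm.map ψm) ((⇑φ ∘ Q) 0)) (hker 0) : CBall F) : CompletedAlgClosure F) ^ j) :
    ∃ (κ : contOneCocycles (restrictedTateRep W F p).toTopRep) (k : absoluteGaloisGroup F → ℤ_[p]) (Λ : BmaxPlus F p),
      (∀ j, (cohomologyMap (tateProjMor W F p j) 1).hom (oneCocycleClass _ κ) = kummerLevelClass W F p j P) ∧
      (∀ σ, κ.1 σ = (k σ • (tateModuleEquiv W F p).symm (Tφ.symm
        ((AinfTop.tateGeomEquivCO F (Wm.map ψm) p hΔ).symm (tateModuleOfPt (CompletedAlgClosure F) (Wm.map ψm) p v₀))) : W.tateModule p)) ∧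
      frobBmaxPlus F p (frobBmaxPlus F p Λ) -
          ainfToBmaxPlus F p (zpToAinf ((HasseManin.tr (E₀.map (Int.castRingHom (ZMod p))) : ℤ) : ℤ_[p])) * frobBmaxPlus F p Λ +
            (p : BmaxPlus F p) * Λ = 0 ∧
      (∀ σ, galBmaxPlus σ Λ = Λ + ainfToBmaxPlus F p (zpToAinf (k σ)) * LT v₀) ∧
      thetaBdR (embBdRHom hp (surjective_fontaineTheta_integerC hp) A * bmaxPlusToBdR F p Λ +
          embBdRHom hp (surjective_fontaineTheta_integerC hp) B * bmaxPlusToBdR F p (frobBmaxPlus F p Λ)) =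
        algebraMap F (CompletedAlgClosure F) cP := by
  have hN1 : 1 ≤ N := D.e_pos.trans_le hN
  -- the `T`-adic Kummer cocycle of `P` IN `W` and its level classes
  have hfix : ∀ σ : absoluteGaloisGroup F, σ • Q 0 = Q 0 := gal_smul_divSeq_zero W F hQ0
  obtain ⟨κ, hκ⟩ := exists_contOneCocycles_tadicKummer W F p hQ hfix
  have h1 := cohomologyMap_tateProjMor_oneCocycleClass_eq_kummerLevelClass W F p hQ hQ0 κ hκ
  -- the image tower `φ ∘ Q` of the model: a division tower of formal points with `Γ_F`-fixed base
  have hQm : ∀ n, p • (⇑φ ∘ Q) (n + 1) = (⇑φ ∘ Q) n := map_divSeq W φ hQ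
  have hfixm : ∀ σ : absoluteGaloisGroup F, σ • (⇑φ ∘ Q) 0 = (⇑φ ∘ Q) 0 := map_divSeq_fix W φ hφ hfix
  have hup := AinfTop.mulPC_zPt_divSeqO Wm ψm hψm (Q := ⇑φ ∘ Q) hQm hker
  have hu₀ := AinfTop.galCBall_zPt_divSeqO_zero Wm ψm (Q := ⇑φ ∘ Q) hfixm hker
  -- `ι(κ_u σ) = (σ φQₙ − φQₙ)ₙ` (B2) and `T_p(φ)(θ_∞(κ σ)) = (σ φQₙ − φQₙ)ₙ`
  have hι : ∀ σ, (AinfTop.tateGeomEquivCO F (Wm.map ψm) p hΔ).symm (tateModuleOfPt (CompletedAlgClosure F) (Wm.map ψm) p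
      (AinfRamTop.kummerCocycleO Wm ψm hψm (fun n => zPt (AinfTop.geomToCO (Wm.map ψm) ((⇑φ ∘ Q) n)) (hker n)) hup hu₀ σ)) =
      TateModule.mk (fun n => σ • (⇑φ ∘ Q) n - (⇑φ ∘ Q) n) (AinfTop.pow_smul_kummerO_eq_zero Wm ψm (Q := ⇑φ ∘ Q) hQm hfixm σ)
        (AinfTop.smul_kummerO_succ Wm ψm (Q := ⇑φ ∘ Q) hQm σ) := fun σ => by
    rw [LinearEquiv.symm_apply_eq]
    exact AinfTop.tateModuleOfPt_kummerCocycleO Wm ψm hψm hΔ (Q := ⇑φ ∘ Q) hQm hfixm hker σ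
  have hT : ∀ σ, Tφ (tateModuleEquiv W F p (κ.1 σ)) =
      TateModule.mk (fun n => σ • (⇑φ ∘ Q) n - (⇑φ ∘ Q) n) (AinfTop.pow_smul_kummerO_eq_zero Wm ψm (Q := ⇑φ ∘ Q) hQm hfixm σ)
        (AinfTop.smul_kummerO_succ Wm ψm (Q := ⇑φ ∘ Q) hQm σ) := fun σ => by
    rw [hκ σ, LinearEquiv.apply_symm_apply]
    exact TateModule.ext fun n => by
      rw [hTφ, TateModule.proj_mk, TateModule.proj_mk, map_sub, hφ]
      rfl
  -- `κ_u(σ) = k(σ) • v₀`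
  choose k hk using fun σ => hgen (AinfRamTop.kummerCocycleO Wm ψm hψm (fun n => zPt (AinfTop.geomToCO (Wm.map ψm) ((⇑φ ∘ Q) n)) (hker n)) hup hu₀ σ)
  -- the CM-fibre transport `Tu` of the Kummer tower `u = z(φ ∘ Q)`, its depth and witness, and `Λ = Λ_N(Tu)`
  obtain ⟨Tu, ⟨hTu, hTuv⟩, -⟩ := exists_unique_int_divisionSeq_of_ramified D Wm E₀ hWE
    (v := fun n => zPt (AinfTop.geomToCO (Wm.map ψm) ((⇑φ ∘ Q) n)) (hker n)) hup
  have hdepth := norm_transport_zero_pow_le_of_norm_pow_le D (u := fun n => zPt (AinfTop.geomToCO (Wm.map ψm) ((⇑φ ∘ Q) n)) (hker n))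
    (Tu := Tu) hTuv hN huN
  have hmem := AinfTop.pow_coe_val_nsmul_divisionLiftPt_mem E₀ (hθ := surjective_fontaineTheta_integerC hp) (u := Tu) hTu hdepth 1
  rw [one_nsmul] at hmem
  obtain ⟨z, hz⟩ := exists_algebraMap_pow_eq_natCast_mul (F := F) (p := p) hmem
  have hz' : algebraMap (Ainf (p := p) F) (bmaxZero F p)
      ((AinfTop.of F p).symm (AinfTop.torsionLift E₀ (surjective_fontaineTheta_integerC hp) Tu hTu)) ^ N = (p : bmaxZero F p) * z := by
    have h := hz
    rw [AinfTop.coe_val_divisionLiftPt] at h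
    exact h
  -- Honda, Kummer identity, `θ`
  have hHonda := AinfTop.frobBmaxPlus_hondaTrace_logSum_divisionLiftPt_eq_zero E₀ (hθ := surjective_fontaineTheta_integerC hp) (u := Tu)
    hTu hN1 hz
  have hKum := fun σ => logSum_transport_kummerCocycleO D Wm E₀ hWE ψm hψm (hθ := surjective_fontaineTheta_integerC hp) hN hLT
    (u := fun n => zPt (AinfTop.geomToCO (Wm.map ψm) ((⇑φ ∘ Q) n)) (hker n)) hup hu₀ huN (Tu := Tu) hTu hTuv hz σ
  have hθb := AinfRamTop.thetaBdR_transportedHodgeCombination_eq D (hθ := surjective_fontaineTheta_integerC hp) Wm E₀ A B dHL hHL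
    (fun n => zPt (AinfTop.geomToCO (Wm.map ψm) ((⇑φ ∘ Q) n)) (hker n)) Tu hup hTu hTuv hN1 hz'
  refine ⟨κ, k, PadicLogSeries.logSum ((algebraMap (Ainf (p := p) F) (bmaxZero F p)).comp zpToAinf) (GaloisContinuity.formalLogNum E₀ p) N
        (algebraMap (Ainf (p := p) F) (bmaxZero F p)
          ((AinfTop.of F p).symm (((AinfTop.divisionLiftPt E₀ (surjective_fontaineTheta_integerC hp) Tu hTu).val :
            (AinfTop.nilTheta F p (surjective_fontaineTheta_integerC hp)).toIdeal) : AinfTop F p))) z,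
    h1, fun σ => ?_, ?_, fun σ => ?_, ?_⟩
  · -- `T_p(φ)θ_∞(κ σ) = (σ φQₙ − φQₙ)ₙ = ι(κ_u σ) = ι(k σ • v₀) = k σ • ι v₀`, then apply `θ_∞⁻¹ T_p(φ)⁻¹`
    have e1 : Tφ (tateModuleEquiv W F p (κ.1 σ)) =
        k σ • (AinfTop.tateGeomEquivCO F (Wm.map ψm) p hΔ).symm (tateModuleOfPt (CompletedAlgClosure F) (Wm.map ψm) p v₀) := by
      rw [hT σ, ← hι σ, hk σ]
      exact (congrArg (fun y => (AinfTop.tateGeomEquivCO F (Wm.map ψm) p hΔ).symm y)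
        (LinearMap.map_smul (tateModuleOfPt (CompletedAlgClosure F) (Wm.map ψm) p) (k σ) v₀)).trans
        (LinearEquiv.map_smul (AinfTop.tateGeomEquivCO F (Wm.map ψm) p hΔ).symm (k σ) _)
    have e2 : κ.1 σ = (tateModuleEquiv W F p).symm (Tφ.symm
        (k σ • (AinfTop.tateGeomEquivCO F (Wm.map ψm) p hΔ).symm (tateModuleOfPt (CompletedAlgClosure F) (Wm.map ψm) p v₀))) := by
      rw [← e1, LinearEquiv.symm_apply_apply, LinearEquiv.symm_apply_apply]
    rw [e2]
    exact (congrArg (tateModuleEquiv W F p).symm (LinearEquiv.map_smul Tφ.symm (k σ) _)).trans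
      (LinearEquiv.map_smul (tateModuleEquiv W F p).symm (k σ) _)
  · -- Honda
    have hofp : AdicCompletion.of (Ideal.span {(p : bmaxZero F p)}) (bmaxZero F p) (p : bmaxZero F p) = (p : BmaxPlus F p) :=
      map_natCast (algebraMap (bmaxZero F p) (BmaxPlus F p)) p
    rw [ainfToBmaxPlus_apply, ← hofp]
    exact hHonda
  · -- Kummer identity
    have h := hKum σ
    rw [hk σ, hsmul, eq_sub_iff_add_eq] at h
    rw [← h, add_comm]
  · -- `θ` (the divisionLiftPt / torsionLift forms of `Λ` agree definitionally, `AinfTop.coe_val_divisionLiftPt`)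
    rw [hcP]
    exact hθb

end Local

/-! ## §2 Kato's formula for `W` at the points mapping to deep formal points of the ORDINARY model (`F = K_v`) -/

section Completion

variable {K : Type} [Field K] [NumberField K] {p : ℕ} [hprime : Fact p.Prime] (v : HeightOneSpectrum (𝓞 K))
  [CharZero (v.adicCompletion K)] [LocallyCompactSpace (absoluteGaloisGroup (v.adicCompletion K))]
  [Fact (¬ IsUnit (p : integerC (v.adicCompletion K)))]
  [IsAdicComplete (Ideal.span {(p : integerC (v.adicCompletion K))}) (integerC (v.adicCompletion K))]
  [CharP 𝓀[v.adicCompletion K] p] [CharZero (CompletedAlgClosure (v.adicCompletion K))]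
  (hpv : valuation (v.adicCompletion K) (p : v.adicCompletion K) < 1)
  (Dv : EisensteinRoot (v.adicCompletion K) p hpv) (Wm : WeierstrassCurve (EisensteinRoot.CoeffDisc Dv))
  (ψm : EisensteinRoot.CoeffDisc Dv →+* LTCoeff (v.adicCompletion K))
  (hψm : ∀ c, algebraMap (LTCoeff (v.adicCompletion K)) (v.adicCompletion K) (ψm c) = EisensteinRoot.CoeffDisc.toF Dv c)
  (hΔ : IsUnit (Wm.map ψm).Δ) [(curveOver (CompletedAlgClosure (v.adicCompletion K)) (Wm.map ψm)).IsElliptic]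
  -- the curve `W/K₀`, the isomorphism of geometric points onto the good model, and its Tate-module map
  {K₀ : Type} [Field K₀] [CharZero K₀] (W : WeierstrassCurve K₀) [W.IsElliptic] [Algebra K₀ (v.adicCompletion K)]
  (φ : geomPoints (W.baseChange (v.adicCompletion K)) ≃+ (AinfTop.curveFO (v.adicCompletion K) (Wm.map ψm)).geomPoints)
  (hφ : ∀ (σ : absoluteGaloisGroup (v.adicCompletion K)) (P : geomPoints (W.baseChange (v.adicCompletion K))), φ (σ • P) = σ • φ P)
  (Tφ : (W.baseChange (v.adicCompletion K)).tateModule p ≃ₗ[ℤ_[p]] (AinfTop.curveFO (v.adicCompletion K) (Wm.map ψm)).tateModule p)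
  (hTφ : ∀ (a : (W.baseChange (v.adicCompletion K)).tateModule p) (n : ℕ), TateModule.proj p n (Tφ a) = φ (TateModule.proj p n a))
  -- the Weil tower of `W`
  (e : (k : ℕ) → geomTorsion W ((p ^ k : ℕ) : ℤ) → geomTorsion W ((p ^ k : ℕ) : ℤ) → AlgebraicClosure K₀)
  (hμ : ∀ k S T, e k S T ^ (p ^ k) = 1) (hadd₁ : ∀ k S₁ S₂ T, e k (S₁ + S₂) T = e k S₁ T * e k S₂ T)
  (hadd₂ : ∀ k S T₁ T₂, e k S (T₁ + T₂) = e k S T₁ * e k S T₂)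
  (hgal : ∀ k (σ : absoluteGaloisGroup K₀) (S T : geomTorsion W ((p ^ k : ℕ) : ℤ)), σ • e k S T = e k (σ • S) (σ • T))
  (hcompat : ∀ k (S T : geomTorsion W ((p ^ (k + 1) : ℕ) : ℤ)),
    e k (torsionMulHom W (p ^ (k + 1)) (p ^ k) p (pow_succ p k).symm S)
      (torsionMulHom W (p ^ (k + 1)) (p ^ k) p (pow_succ p k).symm T) = e (k + 1) S T ^ p)

set_option maxHeartbeats 6400000 in
include hgal hψm hΔ hφ hTφ in
/-- ★★★★ **Kato's explicit reciprocity law at `F = K_v` for a curve `W/K₀` ISOMORPHIC over `F` to a ramified good ORDINARY model `W_D ≡ E₀ (mod ϖ)`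
(along an equivariant `φ : (W ×_{K₀} F)(F̄) ≃ E(F̄)` with `T_p(φ)`), at every cocycle of `T_pW|_{Γ_F}` and every point of `W(F)` carrying a
`p`-power division tower `Q` whose image `φ ∘ Q` consists of FORMAL points of the model, deep at the base — the unit-root frame assembled ALONG `φ`.**
The `φ`-twin of `exists_const_tatePairingPoint_eq_neg_trace_unitRoot_formalPoint` (`φ = id`). Inputs: the cell data OF `W` (Weil tower `e` with
`heL/healt/henondeg`, `ψ = log χ`, `hinj / hde / d`), `W_D ≡ E₀ (mod ϖ)` with `E₀` good at `p` (fibres elliptic), the transported period map `LT`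
at `N ≥ e` (specification, `ℤ_p`-linearity, equivariance), a generator `v₀` of `T_pŴ_D` with character `ρ`, a Hodge line `(A, B, d)`, the unit root
`α` (`‖α‖ = 1`, `α² − a_pα + p = 0`, `απ = p`, `α + π = a_p`) and `H₀ ≠ 0`. Then ONE `c ∈ F` gives, for every `η ∈ Z¹(Γ_F, T_pW)`, every
`P ∈ W(F)` with a tower `Q` in `W(F̄)` (`Q₀ = P`) such that every `φ Qₙ` is formal and `‖z(φ Q₀)‖^N ≤ ‖p‖`, and every `c_P` with
`ι(c_P) = p^N·Σ'[Xʲ]log_{W_D}·z(φ Q₀)ʲ`:  **`⟨[η], P⟩_W = −Tr_{F/ℚ_p}(c_P · exp*_d(η) · c)`** — pairing, `exp*`, `d`, representation of `W` itself.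
[cite: Kato1993LNM1553, Ch. II Thm. 1.4.1 (3)–(4) and Lemma 1.4.3] [cite: BlochKato1990, Ex. 3.10.1, Example 3.11]
[cite: Colmez1992PeriodesAbeliennes, §2] [cite: Tate1967, §4] [cite: SilvermanAEC2009, Prop. VII.2.2, VIII §2 and X §4] -/
theorem exists_const_tatePairingPoint_eq_neg_trace_unitRoot_formalPoint_transport
    (E₀ : WeierstrassCurve ℤ)
    (hWE : Wm.map (Ideal.Quotient.mk (Ideal.span {EisensteinRoot.CoeffDisc.of Dv (AdjoinRoot.root Dv.poly)})) =
      (E₀.map (algebraMap ℤ (EisensteinRoot.CoeffDisc Dv))).map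
        (Ideal.Quotient.mk (Ideal.span {EisensteinRoot.CoeffDisc.of Dv (AdjoinRoot.root Dv.poly)})))
    [(E₀.map (Int.castRingHom ℚ_[p])).IsElliptic] [(E₀.map (Int.castRingHom (ZMod p))).IsElliptic]
    {N : ℕ} (hN : Dv.e ≤ N) {LT : AinfTop.TatePtO (v.adicCompletion K) (Wm.map ψm) p →+ BmaxPlus (v.adicCompletion K) p}
    (hLT : ∀ (τ : AinfTop.TatePtO (v.adicCompletion K) (Wm.map ψm) p) (w : ℕ → (maxNilIdealC (v.adicCompletion K)).toIdeal)
        (hw : ∀ n, AinfTop.mulPC (v.adicCompletion K) p E₀ (w (n + 1)) = w n)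
        (_ : ∀ n, ‖(((w n : (maxNilIdealC (v.adicCompletion K)).toIdeal) : CBall (v.adicCompletion K)) : CompletedAlgClosure (v.adicCompletion K)) -
          (((AinfTop.seqO (Wm.map ψm) τ n : (maxNilIdealC (v.adicCompletion K)).toIdeal) : CBall (v.adicCompletion K)) :
            CompletedAlgClosure (v.adicCompletion K))‖ ≤
          ‖((Dv.rootC : integerC (v.adicCompletion K)) : CompletedAlgClosure (v.adicCompletion K))‖)
        (z : bmaxZero (v.adicCompletion K) p), algebraMap (Ainf (p := p) (v.adicCompletion K)) (bmaxZero (v.adicCompletion K) p)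
          ((AinfTop.of (v.adicCompletion K) p).symm (((AinfTop.divisionLiftPt E₀ (surjective_fontaineTheta_integerC hpv) w hw).val :
            (AinfTop.nilTheta (v.adicCompletion K) p (surjective_fontaineTheta_integerC hpv)).toIdeal) : AinfTop (v.adicCompletion K) p)) ^ N =
          (p : bmaxZero (v.adicCompletion K) p) * z →
        LT τ = PadicLogSeries.logSum ((algebraMap (Ainf (p := p) (v.adicCompletion K)) (bmaxZero (v.adicCompletion K) p)).comp zpToAinf)
          (GaloisContinuity.formalLogNum E₀ p) N
          (algebraMap (Ainf (p := p) (v.adicCompletion K)) (bmaxZero (v.adicCompletion K) p)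
            ((AinfTop.of (v.adicCompletion K) p).symm (((AinfTop.divisionLiftPt E₀ (surjective_fontaineTheta_integerC hpv) w hw).val :
              (AinfTop.nilTheta (v.adicCompletion K) p (surjective_fontaineTheta_integerC hpv)).toIdeal) : AinfTop (v.adicCompletion K) p))) z)
    (hsmul : ∀ (c : ℤ_[p]) (τ : AinfTop.TatePtO (v.adicCompletion K) (Wm.map ψm) p),
      LT (c • τ) = ainfToBmaxPlus (v.adicCompletion K) p (zpToAinf c) * LT τ)
    (hgalLT : ∀ (σ : absoluteGaloisGroup (v.adicCompletion K)) (τ : AinfTop.TatePtO (v.adicCompletion K) (Wm.map ψm) p),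
      galBmaxPlus σ (LT τ) = LT (σ • τ))
    {v₀ : AinfTop.TatePtO (v.adicCompletion K) (Wm.map ψm) p} (hv₀ : v₀ ≠ 0)
    (hgen : ∀ τ : AinfTop.TatePtO (v.adicCompletion K) (Wm.map ψm) p, ∃ c : ℤ_[p], τ = c • v₀)
    (ρ : absoluteGaloisGroup (v.adicCompletion K) → ℤ_[p]) (hρv : ∀ σ : absoluteGaloisGroup (v.adicCompletion K), σ • v₀ = ρ σ • v₀)
    (A B : v.adicCompletion K) (dHL : ℕ)
    (hHL : ∀ n : ℕ, ‖(p : CompletedAlgClosure (v.adicCompletion K)) ^ dHL * PowerSeries.coeff n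
        ((Wm.map ((CBall (v.adicCompletion K)).subtype.comp (EisensteinRoot.CoeffDisc.toCBall Dv))).formalLog -
          PowerSeries.C (algebraMap (v.adicCompletion K) (CompletedAlgClosure (v.adicCompletion K)) A) *
            (E₀.map (Int.castRingHom (CompletedAlgClosure (v.adicCompletion K)))).formalLog -
          PowerSeries.C (algebraMap (v.adicCompletion K) (CompletedAlgClosure (v.adicCompletion K)) B) *
            PowerSeries.expand p hprime.out.ne_zero (E₀.map (Int.castRingHom (CompletedAlgClosure (v.adicCompletion K)))).formalLog)‖ ≤ 1)
    {α π : ℤ_[p]} (hα : ‖α‖ = 1) (hαπ : α * π = p)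
    (hαroot : α ^ 2 - ((HasseManin.tr (E₀.map (Int.castRingHom (ZMod p))) : ℤ) : ℤ_[p]) * α + p = 0)
    (haπ : α + π = ((HasseManin.tr (E₀.map (Int.castRingHom (ZMod p))) : ℤ) : ℤ_[p]))
    (hne : embBdRHom hpv (surjective_fontaineTheta_integerC hpv) A * bmaxPlusToBdR (v.adicCompletion K) p (LT v₀) +
      embBdRHom hpv (surjective_fontaineTheta_integerC hpv) B * bmaxPlusToBdR (v.adicCompletion K) p (frobBmaxPlus (v.adicCompletion K) p (LT v₀)) ≠ 0)
    (ψ : C(absoluteGaloisGroup (v.adicCompletion K), ℤ_[p])) (hψ : ∀ σ τ, ψ (σ * τ) = ψ σ + ψ τ)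
    (hψlog : ∀ τ, (ψ τ : ℚ_[p]) = logCyclotomic (F := (v.adicCompletion K)) p τ)
    (heL : ∀ (c : ℤ_[p]) (S U : W.tateModule p),
      (weilContPairingPadic W (v.adicCompletion K) p e hμ hadd₁ hadd₂ hgal hcompat).toLin (c • S) U =
      twistHom (v.adicCompletion K) p ((weilContPairingPadic W (v.adicCompletion K) p e hμ hadd₁ hadd₂ hgal hcompat).toLin S U) c)
    (healt : ∀ S : W.tateModule p,
      (weilContPairingPadic W (v.adicCompletion K) p e hμ hadd₁ hadd₂ hgal hcompat).toLin S S = 0)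
    (henondeg : ∀ S : W.tateModule p,
      (∀ U, (weilContPairingPadic W (v.adicCompletion K) p e hμ hadd₁ hadd₂ hgal hcompat).toLin S U = 0) → S = 0)
    (hinj : letI := LocalField.padicAlgebra (v.adicCompletion K) p hpv
      (bdRPeriodRingData (F := (v.adicCompletion K)) (p := p) hpv).CupLogInjective (logCyclotomic p)
        (restrictedRationalTateRep W (v.adicCompletion K) p))
    (hde : letI := LocalField.padicAlgebra (v.adicCompletion K) p hpv
      ∀ η : contOneCocycles (restrictedTateRep W (v.adicCompletion K) p).toTopRep,
        (bdRPeriodRingData (F := (v.adicCompletion K)) (p := p) hpv).HasDualExp (logCyclotomic p)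
          (restrictedRationalTateRep W (v.adicCompletion K) p)
          fun σ => TateModule.toRational p (η.1 σ))
    (d : letI := LocalField.padicAlgebra (v.adicCompletion K) p hpv
      (bdRPeriodRingData (F := (v.adicCompletion K)) (p := p) hpv).FilZeroLine
        (restrictedRationalTateRep W (v.adicCompletion K) p)) :
    letI := LocalField.padicAlgebra (v.adicCompletion K) p hpv
    ∃ c : v.adicCompletion K,
      ∀ (η : contOneCocycles (restrictedTateRep W (v.adicCompletion K) p).toTopRep)
        (P : (W.baseChange (v.adicCompletion K)).toAffine.Point)
        (Q : ℕ → geomPoints (W.baseChange (v.adicCompletion K)))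
        (_hQ : ∀ n, p • Q (n + 1) = Q n)
        (_hQ0 : Q 0 = toGeomPoints (W.baseChange (v.adicCompletion K)) P)
        (hker : ∀ n, AinfTop.geomToCO (Wm.map ψm) ((⇑φ ∘ Q) n) ∈ kernel (NormedField.valuation (K := CompletedAlgClosure (v.adicCompletion K)))
          (curveOver (CompletedAlgClosure (v.adicCompletion K)) (Wm.map ψm))),
        ‖((zPt (AinfTop.geomToCO (Wm.map ψm) ((⇑φ ∘ Q) 0)) (hker 0) : CBall (v.adicCompletion K)) : CompletedAlgClosure (v.adicCompletion K))‖ ^ N ≤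
            ‖(p : CompletedAlgClosure (v.adicCompletion K))‖ →
        ∀ cP : v.adicCompletion K,
          algebraMap (v.adicCompletion K) (CompletedAlgClosure (v.adicCompletion K)) cP =
            (p : CompletedAlgClosure (v.adicCompletion K)) ^ N *
              ∑' j : ℕ, PowerSeries.coeff j (Wm.map ((CBall (v.adicCompletion K)).subtype.comp (EisensteinRoot.CoeffDisc.toCBall Dv))).formalLog *
                ((zPt (AinfTop.geomToCO (Wm.map ψm) ((⇑φ ∘ Q) 0)) (hker 0) : CBall (v.adicCompletion K)) : CompletedAlgClosure (v.adicCompletion K)) ^ j →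
          ((tatePairingPoint W (v.adicCompletion K) p e hμ hadd₁ hadd₂ hgal hcompat
              (oneCocycleClass _ η) P : ℤ_[p]) : ℚ_[p]) =
            -Algebra.trace ℚ_[p] (v.adicCompletion K) (cP * (expStarCoord W hpv d η * c)) := by
  -- the transported frame vector (generic `F`, STEPWISE)
  have hD1 := restrictedTateRep_frameVector_transport (hp := hpv) (D := Dv) (Wm := Wm) (ψm := ψm) W φ hφ Tφ hTφ hΔ hv₀ ρ hρv
  obtain ⟨hw₀, hρ0, hρw⟩ := hD1
  -- the frame period data (model side, verbatim as for `φ = id`)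
  have hD2 := framePeriod_honda_gal_theta (hp := hpv) (D := Dv) (W := Wm) (E₀ := E₀) hWE (ψ := ψm) hψm hN hLT hsmul hgalLT v₀ ρ hρv
    A B dHL hHL haπ
  obtain ⟨hx, hρx, hfil⟩ := hD2
  have hD3 := exists_unitRootPeriod_and_ne_cyclotomic (hp := hpv) (E₀ := E₀) hα hαπ hαroot hx ρ hρx hfil hne
  obtain ⟨u, hu, hφu, hρχ⟩ := hD3
  -- the law in the frame, for `W` itself
  have hF1 := exists_const_tatePairingPoint_eq_neg_trace_unitRootFrame v W e hμ hadd₁ hadd₂ hgal hcompat hpv ψ hψ hψlog heL healt henondeg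
  have hF2 := hF1 hinj hde d hw₀ ρ hρ0 hρw hαπ hu hφu hx hρx hfil hne hρχ
  obtain ⟨c, hc⟩ := hF2
  clear hF1
  refine ⟨c, fun η P Q hQ hQ0 hker huN cP hcP => ?_⟩
  -- the per-point package along `φ`
  have hP1 := exists_kummerPackage_through_iota_transport (hp := hpv) (D := Dv) (Wm := Wm) (ψm := ψm) hψm W φ hφ Tφ hTφ E₀ hWE hΔ hN hLT
    hsmul hgen A B dHL hHL P Q hQ hQ0 hker huN cP hcP
  obtain ⟨κ, k, Λ, h1, hk, hΛ, hgalΛ, hθ⟩ := hP1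
  rw [← haπ] at hΛ
  exact hc η κ P h1 k hk Λ hΛ hgalΛ cP hθ

end Completion

end Literature.NumberTheory.PAdicHodge

end
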